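import Literature.NumberTheory.ComplexMultiplication.EllipticUnits.ImaginaryQuadraticMainConjectureCarriersO
import HarnessLib

/-!
# Route `SignedLowerHalves`, crux L `SmallImageLowerHalfBothSigns` (stmt-BirchSwinnertonDyer-23599), line `rtt_w3` v14 → v15 — E2, row D-tw-coh (LEAD, bookkeeping
# for honda's part 3): COMPATIBLE LEVEL MAPS BETWEEN TWO MODELS OF `𝐇^i` LIFT UNIQUELY TO THE LIMITS; LEVEL ISOMORPHISMS LIFT TO `≃+`

WHY (LEAD `cruxlead-stmt-BirchSwinnertonDyer-23599` g11; BRIEF-E2 rev 5.2 §3 row D-tw-coh). honda g23 has the finite-level twists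
`levelTwistEquivO : levelCohO S P θ U k i ≃+ levelCohO S P θ' U k i` (p785683) and their compatibility with corestriction / reduction / scalars
(p786037, part 2a). The Iwasawa-level additive equivalences `eᵢ : 𝐇^i(θ) ≃+ 𝐇^i(θ')` that the consumers take (p784139/p784278: `e₀ e₁ e₂`) are then
pure bookkeeping over the pins (P1)–(P4) of `JohnsonLeungKings2011.IwasawaCohomologyDataO`: ★★ `exists_unique_liftLevelMaps` (a family
`t n k : layerCohO θ n k i →+ layerCohO θ' n k i` commuting with `layerCoresO` and `layerRedO` lifts to a unique additive `T : I.H →+ I'.H` with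
`I'.proj n k (T x) = t n k (I.proj n k x)`), ★★ `exists_addEquiv_of_levelEquivs` (`∃ e : I.H ≃+ I'.H` computed levelwise) for levelwise inverse
families, `eq_of_proj_eq` (elements given levelwise). ∃-forms only (no defs). Models may have different `γ₁ γ₂ θ` (same tower `κ₁ κ₂`, same `𝔣`). Semilinearity of `T` is honda's
`addMonoidHom_map_smul_of_proj` (p782360) once the level maps twist the conjugations.

THEOREMS ONLY (`--supports stmt-BirchSwinnertonDyer-23599` helper); closes nothing; crux L, crux M, E2 and BSD remain OPEN and are proved for NO curve by any of this.
[cite: JohnsonLeungKings2011, §4.2 Def. 4.2 (94), §5.2] [cite: Kato2004Asterisque, §8.2 (p. 180)]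
-/

set_option autoImplicit false
-- the Theorems namespace of this sub repeats the summit name by design (D-0017 nested layout)
set_option linter.dupNamespace false

noncomputable section

open scoped NumberField
open Field IsDedekindDomain
open Literature.NumberTheory.EllipticCurves
open Literature.NumberTheory.ComplexMultiplication.EllipticUnits.JohnsonLeungKings2011

namespace Summit.BirchSwinnertonDyer.BirchSwinnertonDyer.Theorems.SmallImageRttD2Twist

section Lift

variable {K : Type} [Field K] [NumberField K] {p : ℕ} [Fact p.Prime] {S : Set (PadicAlgCl p)}
  {κ₁ κ₂ : ZpExtension K p} {γ₁ γ₂ γ₁' γ₂' : absoluteGaloisGroup K}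
  {θ θ' : absoluteGaloisGroup K →ₜ* (padicCoeffIntegers S)ˣ} {𝔣 : Ideal (𝓞 K)} {i : ℕ}
  (I : IwasawaCohomologyDataO S κ₁ κ₂ γ₁ γ₂ θ 𝔣 i) (I' : IwasawaCohomologyDataO S κ₁ κ₂ γ₁' γ₂' θ' 𝔣 i)
  (t : ∀ n k : ℕ, layerCohO S κ₁ κ₂ θ 𝔣 n k i →+ layerCohO S κ₁ κ₂ θ' 𝔣 n k i)
  (ht_cores : ∀ (n k : ℕ) (y : layerCohO S κ₁ κ₂ θ 𝔣 (n + 1) k i),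
    layerCoresO S κ₁ κ₂ θ' 𝔣 n k i (t (n + 1) k y) = t n k (layerCoresO S κ₁ κ₂ θ 𝔣 n k i y))
  (ht_red : ∀ (n k : ℕ) (y : layerCohO S κ₁ κ₂ θ 𝔣 n (k + 1) i),
    layerRedO S κ₁ κ₂ θ' 𝔣 n k i (t n (k + 1) y) = t n k (layerRedO S κ₁ κ₂ θ 𝔣 n k i y))

include ht_cores ht_red in
/-- The image family `(t n k (proj n k x))` of an element is compatible. [cite: JohnsonLeungKings2011, §4.2 Def. 4.2 (94)] -/
theorem isCompatibleFamilyO_levelMaps_proj (x : I.H) : IsCompatibleFamilyO S κ₁ κ₂ θ' 𝔣 i fun n k ↦ t n k (I.proj n k x) :=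
  ⟨fun n k ↦ show layerCoresO S κ₁ κ₂ θ' 𝔣 n k i (t (n + 1) k (I.proj (n + 1) k x)) = t n k (I.proj n k x) by
      rw [ht_cores, I.proj_cores],
    fun n k ↦ show layerRedO S κ₁ κ₂ θ' 𝔣 n k i (t n (k + 1) (I.proj n (k + 1) x)) = t n k (I.proj n k x) by
      rw [ht_red, I.proj_red]⟩

include ht_cores ht_red in
/-- ★★ **Compatible level maps lift uniquely to the limits.** [cite: JohnsonLeungKings2011, §4.2 Def. 4.2 (94), §5.2] [cite: Kato2004Asterisque, §8.2 (p. 180)] -/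
theorem exists_unique_liftLevelMaps : ∃! T : I.H →+ I'.H, ∀ (n k : ℕ) (x : I.H), I'.proj n k (T x) = t n k (I.proj n k x) := by
  have hex : ∀ x : I.H, ∃! x' : I'.H, ∀ n k, I'.proj n k x' = t n k (I.proj n k x) := fun x ↦
    I'.exists_unique_of_isCompatibleFamilyO (isCompatibleFamilyO_levelMaps_proj I t ht_cores ht_red x)
  choose F hF using fun x ↦ (hex x).exists
  have hF' : ∀ x n k, I'.proj n k (F x) = t n k (I.proj n k x) := hF
  let T : I.H →+ I'.H :=
    { toFun := F
      map_zero' := I'.proj_injective _ fun n k ↦ by rw [hF' 0, map_zero, map_zero]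
      map_add' := fun x y ↦ sub_eq_zero.mp (I'.proj_injective _ fun n k ↦ by
        rw [map_sub, map_add, hF' (x + y), hF' x, hF' y, map_add, map_add, sub_self]) }
  refine ⟨T, fun n k x ↦ hF' x n k, fun T' hT' ↦ ?_⟩
  ext x
  exact (hex x).unique (fun n k ↦ hT' n k x) (fun n k ↦ hF' x n k)

include ht_cores ht_red in
/-- ★★ **Levelwise additive isomorphisms (with compatible inverses) lift to `I.H ≃+ I'.H`, computed levelwise** — the shape of the consumers'
`e₀ e₁ e₂` (p784139, p784278) from honda's `levelTwistEquivO` (p785683). (∃-form: theorems only.) [cite: JohnsonLeungKings2011, §4.2 Def. 4.2 (94), §5.2]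
[cite: Kato2004Asterisque, §8.2 (p. 180)] -/
theorem exists_addEquiv_of_levelEquivs (t' : ∀ n k : ℕ, layerCohO S κ₁ κ₂ θ' 𝔣 n k i →+ layerCohO S κ₁ κ₂ θ 𝔣 n k i)
    (ht'_cores : ∀ (n k : ℕ) (y : layerCohO S κ₁ κ₂ θ' 𝔣 (n + 1) k i),
      layerCoresO S κ₁ κ₂ θ 𝔣 n k i (t' (n + 1) k y) = t' n k (layerCoresO S κ₁ κ₂ θ' 𝔣 n k i y))
    (ht'_red : ∀ (n k : ℕ) (y : layerCohO S κ₁ κ₂ θ' 𝔣 n (k + 1) i),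
      layerRedO S κ₁ κ₂ θ 𝔣 n k i (t' n (k + 1) y) = t' n k (layerRedO S κ₁ κ₂ θ' 𝔣 n k i y))
    (hinv : ∀ (n k : ℕ) (y : layerCohO S κ₁ κ₂ θ 𝔣 n k i), t' n k (t n k y) = y)
    (hinv' : ∀ (n k : ℕ) (y : layerCohO S κ₁ κ₂ θ' 𝔣 n k i), t n k (t' n k y) = y) :
    ∃ e : I.H ≃+ I'.H, ∀ (n k : ℕ) (x : I.H), I'.proj n k (e x) = t n k (I.proj n k x) := by
  obtain ⟨T, hT, -⟩ := exists_unique_liftLevelMaps I I' t ht_cores ht_red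
  obtain ⟨T', hT', -⟩ := exists_unique_liftLevelMaps I' I t' ht'_cores ht'_red
  refine ⟨{ T with
    invFun := T'
    left_inv := fun x ↦ sub_eq_zero.mp (I.proj_injective _ fun n k ↦ by
      rw [map_sub, AddMonoidHom.toFun_eq_coe, hT', hT, hinv, sub_self])
    right_inv := fun x ↦ sub_eq_zero.mp (I'.proj_injective _ fun n k ↦ by
      rw [map_sub, AddMonoidHom.toFun_eq_coe, hT, hT', hinv', sub_self]) }, fun n k x ↦ hT n k x⟩

/-- **An element given levelwise**: if `proj' n k z = t n k (proj n k x)` at all levels then `T x = z` for any additive `T` with the levelwise property —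
how a norm-compatible family (e.g. the twisted zeta element) is identified with a named element of `I'.H` (the consumers' `haZ`). [cite: JohnsonLeungKings2011, §5.2] -/
theorem eq_of_proj_eq {T : I.H →+ I'.H} (hT : ∀ (n k : ℕ) (x : I.H), I'.proj n k (T x) = t n k (I.proj n k x))
    {x : I.H} {z : I'.H} (hz : ∀ n k, I'.proj n k z = t n k (I.proj n k x)) : T x = z :=
  sub_eq_zero.mp (I'.proj_injective _ fun n k ↦ by rw [map_sub, hT, hz, sub_self])

end Lift

end Summit.BirchSwinnertonDyer.BirchSwinnertonDyer.Theorems.SmallImageRttD2Twist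

end
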